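import Summits.QuantumFields.YangMills.Theorems.EquipartitionCriticalityLatticeGapLargeBetaStubAnchorZero

/-!
# `LatticeGapLargeBeta` — line `Sketch` (card `af-staircase-transport`): what the heart owes at its FIRST rung

Support file for crux stmt-QuantumFields-8761
(`Summit.QuantumFields.YangMills.Theses.EquipartitionCriticality.LatticeGapLargeBeta`), line `Sketch`
(skeleton `Cruxes/LatticeGapLargeBeta/Lines/Sketch.lean`, namespace `…AfStaircase`, reshape r1), whose only open
stub is the heart `stub_staircase` (ladder form):

  ∃ Δβ > 0, θ ∈ (0,1], c ≥ 1, β⋆, L₀, a ladder `0 = lad 0 < lad 1 < ⋯` (steps ≤ Δβ, reaching β⋆) such that for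
  all β ≥ 0, 0 < δ ≤ Δβ with β + δ a ladder point or ≥ β⋆, S ≥ L₀ β, m ∈ (0,1], K ≥ 2:
  SC(β, S, m, K) ⇒ SC(β+δ, 2S, θm, cK) ∧ SC(β+δ, 2S+1, θm, cK),

in the currency SC(β, S, m, K) :≡ for all species `A, B` with sup bounds `a, b` and supports in the time slab
`|t| ≤ w`, and all `n ≤ S`, `|latticeConnectedCorr r.ρ β (2S+1) A.F B.F n| ≤ K a b e^{2mw} e^{−mn}`.

This file records, kernel-checked, a DEBT of the heart that the crux itself does not carry (lead c2's census
item; it is one half of the reason the line is handed back rather than re-driven): since the anchor SC(0, S, 1, 2)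
holds on EVERY torus (`stub_anchorZero`, landed p108628 — at `β = 0` the Wilson state is the Haar product),
the very first rung of any staircase witnessing the heart (from `β = 0` to the first ladder point `lad 1 ∈ (0, Δβ]`,
with `m = 1`, `K = 2`) asserts

  `uniformSlabClustering_firstRung_of_staircase` : ∃ β₁ > 0, θ ∈ (0,1], K ≥ 2, S₁ : for all S ≥ S₁, SC(β₁, S, θ, K),

i.e. VOLUME-UNIFORM exponential time-clustering of ALL bounded gauge-invariant local observables, with
constants seeing the observables only through their sup norms and time width, on all large tori `(2S+1)⁴`, at
one fixed small positive coupling `β₁` — for every compact `G` with a continuous unitary `ρ` (simplicity is not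
used by the rung).  This is the finite-torus, sup-norm × width form of strong-coupling clustering; it is NOT a
corollary of the tree's strong-coupling theorems (`osterwalder_seiler_torusClustering_holds` is pointwise in the
shift / eventually in the side with pair- and `β`-dependent constants; `osterwalderSeiler_clustering_supNorm` is a
free-boundary statement with `∃ c(F₁,F₂)`), and obtaining it needs the `L²` transfer-matrix route on the cylinder
(cluster expansion uniformly in the spatial volume + reflection positivity + thermal-trace control; crux
`NOTES.md` §10(ii)).  The crux (`β ≥ β₁` only, `β₁` as large as one likes) owes nothing at small `β`.
-/

open scoped BigOperators Topology
open MeasureTheory ProbabilityTheory Filter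
open Literature.MathematicalPhysics.QuantumFieldTheory Literature.MathematicalPhysics.QuantumLattice

noncomputable section

namespace Summit.QuantumFields.YangMills.Theorems.LatticeGapLargeBeta.AfStaircase

/-- **The first rung of the staircase is volume-uniform strong-coupling clustering in the SC currency.**
If the heart `stub_staircase` of line `Sketch` holds for `(G, r)` (its body, VERBATIM, as the hypothesis), then
there are a coupling `β₁ > 0` (the first ladder point `lad 1 ≤ Δβ`), a rate `θ ∈ (0, 1]`, a prefactor `K ≥ 2`
(namely `2c`) and a side threshold `S₁` (namely `2 L₀(0)`) such that on every torus `(2S+1)⁴` with `S ≥ S₁` all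
species cluster at `β₁` in the SC currency: for all `A, B` with sup bounds `a, b` and supports in the time slab
`|t| ≤ w`, and all `n ≤ S`, `|⟨A τ_n B⟩ − ⟨A⟩⟨B⟩| ≤ K a b e^{2θw} e^{−θn}`.  Proof: one rung from the anchor
`stub_anchorZero` (SC(0, S', 1, 2) for every `S'`) with `δ = lad 1`, landing at the ladder point `lad 1`, applied
at half-side `S' = ⌊S/2⌋ ≥ L₀(0)`; the two conjuncts of the rung cover `S = 2S'` and `S = 2S' + 1`. [folklore] -/
theorem uniformSlabClustering_firstRung_of_staircase :
    ∀ (G : Type) [Group G] [TopologicalSpace G] [IsTopologicalGroup G] [CompactSpace G]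
      [MeasurableSpace G] [BorelSpace G] (r : LatticeRep G),
    (∃ (Δβ θ c βs : ℝ) (L₀ : ℝ → ℕ) (lad : ℕ → ℝ), 0 < Δβ ∧ 0 < θ ∧ θ ≤ 1 ∧ 1 ≤ c ∧
      lad 0 = 0 ∧ (∀ k : ℕ, lad k < lad (k + 1) ∧ lad (k + 1) ≤ lad k + Δβ) ∧ (∃ k : ℕ, βs ≤ lad k) ∧
      ∀ β : ℝ, 0 ≤ β → ∀ δ : ℝ, 0 < δ → δ ≤ Δβ → (βs ≤ β + δ ∨ ∃ k : ℕ, β + δ = lad k) →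
      ∀ S : ℕ, L₀ β ≤ S → ∀ m K : ℝ, 0 < m → m ≤ 1 → 2 ≤ K →
        (∀ (A B : YMSpecies G) (a b : ℝ) (w : ℕ), (∀ U, |A.F U| ≤ a) → (∀ U, |B.F U| ≤ b) →
          (∀ e ∈ A.supp, |e.1 0| ≤ (w : ℤ)) → (∀ e ∈ B.supp, |e.1 0| ≤ (w : ℤ)) →
          ∀ n : ℕ, n ≤ S →
            |latticeConnectedCorr r.ρ β (2 * S + 1) A.F B.F n| ≤
              K * a * b * Real.exp (m * (2 * w)) * Real.exp (-(m * n))) →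
        (∀ (A B : YMSpecies G) (a b : ℝ) (w : ℕ), (∀ U, |A.F U| ≤ a) → (∀ U, |B.F U| ≤ b) →
          (∀ e ∈ A.supp, |e.1 0| ≤ (w : ℤ)) → (∀ e ∈ B.supp, |e.1 0| ≤ (w : ℤ)) →
          ∀ n : ℕ, n ≤ 2 * S →
            |latticeConnectedCorr r.ρ (β + δ) (2 * (2 * S) + 1) A.F B.F n| ≤
              c * K * a * b * Real.exp (θ * m * (2 * w)) * Real.exp (-(θ * m * n))) ∧
        (∀ (A B : YMSpecies G) (a b : ℝ) (w : ℕ), (∀ U, |A.F U| ≤ a) → (∀ U, |B.F U| ≤ b) →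
          (∀ e ∈ A.supp, |e.1 0| ≤ (w : ℤ)) → (∀ e ∈ B.supp, |e.1 0| ≤ (w : ℤ)) →
          ∀ n : ℕ, n ≤ 2 * S + 1 →
            |latticeConnectedCorr r.ρ (β + δ) (2 * (2 * S + 1) + 1) A.F B.F n| ≤
              c * K * a * b * Real.exp (θ * m * (2 * w)) * Real.exp (-(θ * m * n)))) →
    ∃ (β₁ θ K : ℝ) (S₁ : ℕ), 0 < β₁ ∧ 0 < θ ∧ θ ≤ 1 ∧ 2 ≤ K ∧ ∀ S : ℕ, S₁ ≤ S →
      ∀ (A B : YMSpecies G) (a b : ℝ) (w : ℕ), (∀ U, |A.F U| ≤ a) → (∀ U, |B.F U| ≤ b) →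
        (∀ e ∈ A.supp, |e.1 0| ≤ (w : ℤ)) → (∀ e ∈ B.supp, |e.1 0| ≤ (w : ℤ)) →
        ∀ n : ℕ, n ≤ S →
          |latticeConnectedCorr r.ρ β₁ (2 * S + 1) A.F B.F n| ≤
            K * a * b * Real.exp (θ * (2 * w)) * Real.exp (-(θ * n)) := by
  intro G _ _ _ _ _ _ r hH
  obtain ⟨Δβ, θ, c, βs, L₀, lad, _, hθ, hθ1, hc, h0, hlad, _, hrung⟩ := hH
  have h01 : lad 0 < lad 1 ∧ lad 1 ≤ lad 0 + Δβ := hlad 0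
  rw [h0] at h01
  -- witnesses: the first ladder point (written `0 + lad 1`, the rung's landing point from `β = 0`), the rate
  -- `θ * 1` and the prefactor `c * 2` of one rung applied to the anchor's `m = 1`, `K = 2`
  refine ⟨0 + lad 1, θ * 1, c * 2, 2 * L₀ 0, by linarith [h01.1], by linarith, by linarith, by linarith, ?_⟩
  intro S hS
  have step := fun (S' : ℕ) (hS' : L₀ 0 ≤ S') =>
    hrung 0 le_rfl (lad 1) h01.1 (by linarith [h01.2]) (Or.inr ⟨1, zero_add _⟩) S' hS' 1 2 one_pos le_rfl le_rfl
      (stub_anchorZero G r S')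
  obtain ⟨S', rfl | rfl⟩ := Nat.even_or_odd' S
  · exact (step S' (by omega)).1
  · exact (step S' (by omega)).2

end Summit.QuantumFields.YangMills.Theorems.LatticeGapLargeBeta.AfStaircase

end
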